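import Summits.AtomisticToContinuum.HydrodynamicLimit.Theses.OneFlightGossipEngine
import Literature.Analysis.FluidPDE.HardSphereFlowJointMeasurable
import Summits.AtomisticToContinuum.HydrodynamicLimit.Theorems.ImplosionDichotomyHydroLimitInBandWindowContinuityStreaming
import Literature.MathematicalPhysics.KineticTheory.HardSphereEulerProofs
import HarnessLib

/-!
# Third moments over a window under the true law (stub `stub_thirdMomentWindow`)

Crux `Summit.AtomisticToContinuum.HydrodynamicLimit.Theses.OneFlightGossipEngine.ClampedCurrentsDock`
(stmt-AtomisticToContinuum-14680), line `IdeatorTwoSketch`, registered stub TM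
`stub_thirdMomentWindow : ThirdMomentWindow` (re-declared verbatim from the line skeleton): under the local Gibbs law
`λ = localGibbsLaw σ a₀ u₀ θ₀ N Φ` (`σ < 1/2`, continuous positive profiles), the per-time cubic-tail bound
`E_λ[(N+1)⁻¹ Σ_i 𝟙{M < ‖v_i(r)‖} ‖v_i(r)‖³] ≤ 1` at every `r ∈ [s, s + w]` gives
`E_λ[∫_s^{s+w} Σ_i ‖v_i(r)‖³ dr] ≤ w (N+1) (M³ + 1)`.

Proof: the pointwise split `‖v‖³ ≤ M³ + 𝟙{M < ‖v‖} ‖v‖³` (`0 ≤ M`); along a good orbit (a set of full `λ`-measure,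
`EntropyClockDock.ae_mem_good_localGibbsLaw`) the cubic velocity sum is measurable in time and bounded by the conserved
energy (`HydroLimitInBandContinuity.integrableOn_cubicSum`), so the inner interval integral is a lower integral; Tonelli
in `(r, z)` through the jointly measurable flow modified off the good set
(`BoltzmannGreenKuboOrthMomentum.measurable_flowMod`); at each time of the window the hypothesis and `λ(univ) = 1`
bound the `z`-integral by `(N+1)(M³+1)` (`lintegral_cubeSum_le`); integrate the constant over `[s, s + w]`.
This is the sibling of `HydroLimitInBandContinuity.lintegral_streamingBound_le` (crux `HydroLimitInBand`, 9133) with the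
constant bookkeeping `M³ + tail` in place of `M₊|v|² + tail`.

References: H.-T. Yau, Lett. Math. Phys. 22 (1991) §2; H. Spohn, *Large Scale Dynamics of Interacting Particles*
(1991), Part I §3.2.
-/

noncomputable section

namespace Summit.AtomisticToContinuum.HydrodynamicLimit.Theorems.ClampedCurrentsDockThirdMoment

open scoped BigOperators ENNReal Classical Interval
open MeasureTheory Filter Set Topology InformationTheory
open Literature.MathematicalPhysics.KineticTheory Literature.Analysis.FluidPDE Literature.Analysis.FunctionSpaces
open Summit.AtomisticToContinuum.HydrodynamicLimit.Theses.OneFlightGossipEngine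
open Summit.AtomisticToContinuum.HydrodynamicLimit.Theorems

/-! ### §1 The registered statement -/

/-- registered stub signature TM of line IdeatorTwoSketch, crux ClampedCurrentsDock — route-internal, not a cited fact -/
def ThirdMomentWindow : Prop :=
  ∀ (σ : ℝ) (N : ℕ) (Φ : HardSphereFlow (Torus.geometry (Fin 3)) (hsDiameter σ N) (N + 1))
    (a₀ θ₀ : T3 → ℝ) (u₀ : T3 → V3) (M s w : ℝ), 0 < σ → σ < 1 / 2 →
    Continuous a₀ → Continuous θ₀ → Continuous u₀ → (∀ x, 0 < a₀ x) → (∀ x, 0 < θ₀ x) → 0 ≤ M → 0 ≤ s → 0 ≤ w →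
    (∀ r ∈ Set.Icc s (s + w), ∫⁻ z, ENNReal.ofReal (((N : ℝ) + 1)⁻¹ * ∑ i : Fin (N + 1),
        Set.indicator {v : V3 | M < ‖v‖} (fun v => ‖v‖ ^ 3) ((Φ.flow r z i).2)) ∂(localGibbsLaw σ a₀ u₀ θ₀ N Φ) ≤
        ENNReal.ofReal 1) →
    ∫⁻ z, ENNReal.ofReal (∫ r in s..(s + w), ∑ i : Fin (N + 1), ‖(Φ.flow r z i).2‖ ^ 3)
        ∂(localGibbsLaw σ a₀ u₀ θ₀ N Φ) ≤ ENNReal.ofReal (w * ((N : ℝ) + 1) * (M ^ 3 + 1))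

/-! ### §2 Pointwise: the cubic split at level `M` and integrability along a good orbit -/

open Summit.AtomisticToContinuum.HydrodynamicLimit.Theorems.BoltzmannGreenKuboOrthMomentum
  (flowMod measurable_flowMod flowMod_of_mem)
open Summit.AtomisticToContinuum.HydrodynamicLimit.Theorems.HydroLimitInBandContinuity
  (measurable_flow_of_mem integrableOn_cubicSum)
open Summit.AtomisticToContinuum.HydrodynamicLimit.Theorems.EntropyClockDock (ae_mem_good_localGibbsLaw)

variable {σ : ℝ} {N : ℕ}

/-- `‖v‖³ ≤ M³ + 𝟙{M < ‖v‖} ‖v‖³` for `0 ≤ M`. [folklore] -/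
theorem norm_cube_le_of_nonneg {M : ℝ} (hM : 0 ≤ M) (v : V3) :
    ‖v‖ ^ 3 ≤ M ^ 3 + Set.indicator {w : V3 | M < ‖w‖} (fun w => ‖w‖ ^ 3) v := by
  by_cases h : M < ‖v‖
  · rw [indicator_of_mem (show v ∈ {w : V3 | M < ‖w‖} from h)]
    exact le_add_of_nonneg_left (pow_nonneg hM 3)
  · rw [indicator_of_notMem (show v ∉ {w : V3 | M < ‖w‖} from h), add_zero]
    exact pow_le_pow_left₀ (norm_nonneg v) (not_lt.1 h) 3

/-- The cubic velocity sum split at level `M`: `Σ_i ‖v_i‖³ ≤ (N+1) M³ + Σ_i 𝟙{M < ‖v_i‖} ‖v_i‖³`. [folklore] -/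
theorem sum_norm_cube_le (Φ : HardSphereFlow (Torus.geometry (Fin 3)) (hsDiameter σ N) (N + 1)) {M : ℝ}
    (hM : 0 ≤ M) (r : ℝ) (z : Config (N + 1) (Fin 3) T3) :
    ∑ i, ‖(Φ.flow r z i).2‖ ^ 3 ≤
      ((N : ℝ) + 1) * M ^ 3 + ∑ i, Set.indicator {v : V3 | M < ‖v‖} (fun v => ‖v‖ ^ 3) ((Φ.flow r z i).2) := by
  calc ∑ i, ‖(Φ.flow r z i).2‖ ^ 3
      ≤ ∑ i, (M ^ 3 + Set.indicator {v : V3 | M < ‖v‖} (fun v => ‖v‖ ^ 3) ((Φ.flow r z i).2)) :=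
        Finset.sum_le_sum fun i _ => norm_cube_le_of_nonneg hM _
    _ = ((N : ℝ) + 1) * M ^ 3 + ∑ i, Set.indicator {v : V3 | M < ‖v‖} (fun v => ‖v‖ ^ 3) ((Φ.flow r z i).2) := by
        rw [Finset.sum_add_distrib, Finset.sum_const, Finset.card_univ, Fintype.card_fin, nsmul_eq_mul]
        push_cast
        ring

/-- The cubic velocity sum `r ↦ Σ_i ‖v_i(r)‖³` is integrable on every bounded window along a good orbit (measurable in
time, dominated by `Σ_i (1 + ‖v_i(r)‖³)`, which is bounded by the conserved energy). [folklore] -/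
theorem integrableOn_cubeSum (Φ : HardSphereFlow (Torus.geometry (Fin 3)) (hsDiameter σ N) (N + 1))
    {z : Config (N + 1) (Fin 3) T3} (hz : z ∈ Φ.good) (s s' : ℝ) :
    IntegrableOn (fun r => ∑ i, ‖(Φ.flow r z i).2‖ ^ 3) (Ioc s s') := by
  have hm : Measurable fun r => ∑ i, ‖(Φ.flow r z i).2‖ ^ 3 :=
    Finset.measurable_sum _ fun i _ => ((measurable_pi_apply i).comp (measurable_flow_of_mem Φ hz)).snd.norm.pow_const 3
  refine Integrable.mono' (integrableOn_cubicSum Φ hz 1 s s') hm.aestronglyMeasurable (ae_of_all _ fun r => ?_)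
  rw [Real.norm_eq_abs, abs_of_nonneg (Finset.sum_nonneg fun i _ => by positivity), one_mul]
  exact Finset.sum_le_sum fun i _ => le_add_of_nonneg_left zero_le_one

/-! ### §3 In mean: one time, then the window (Tonelli) -/

variable {a₀ θ₀ : T3 → ℝ} {u₀ : T3 → V3}

/-- **The cubic velocity sum at a fixed time, in mean.** Under `λ_N = localGibbsLaw σ a₀ u₀ θ₀ N Φ` (`σ ≤ 1/2`,
continuous positive profiles), if the cubic tail at time `r` satisfies `E[(N+1)⁻¹ Σ_i 𝟙{M < ‖v_i(r)‖} ‖v_i(r)‖³] ≤ 1`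
(`0 ≤ M`), then `E[Σ_i ‖v_i(r)‖³] ≤ (N+1) (M³ + 1)`. [folklore] -/
theorem lintegral_cubeSum_le (hσ2 : σ ≤ 1 / 2) (ha : Continuous a₀) (hθ : Continuous θ₀)
    (hu : Continuous u₀) (ha0 : ∀ x, 0 < a₀ x) (hθ0 : ∀ x, 0 < θ₀ x)
    (Φ : HardSphereFlow (Torus.geometry (Fin 3)) (hsDiameter σ N) (N + 1)) {M : ℝ} (hM : 0 ≤ M) {r : ℝ}
    (hECT : ∫⁻ z, ENNReal.ofReal (((N : ℝ) + 1)⁻¹ * ∑ i : Fin (N + 1),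
      Set.indicator {v : V3 | M < ‖v‖} (fun v => ‖v‖ ^ 3) ((Φ.flow r z i).2)) ∂(localGibbsLaw σ a₀ u₀ θ₀ N Φ) ≤
      ENNReal.ofReal 1) :
    ∫⁻ z, ENNReal.ofReal (∑ i, ‖(Φ.flow r z i).2‖ ^ 3) ∂(localGibbsLaw σ a₀ u₀ θ₀ N Φ) ≤
      ENNReal.ofReal (((N : ℝ) + 1) * (M ^ 3 + 1)) := by
  haveI := isProbabilityMeasure_localGibbsLaw ha hθ hu ha0 hθ0 hσ2 N Φ
  have hN : (0 : ℝ) < (N : ℝ) + 1 := by positivity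
  set f₂ : Config (N + 1) (Fin 3) T3 → ℝ≥0∞ := fun z => ENNReal.ofReal (((N : ℝ) + 1)⁻¹ * ∑ i : Fin (N + 1),
    Set.indicator {v : V3 | M < ‖v‖} (fun v => ‖v‖ ^ 3) ((Φ.flow r z i).2)) with hf₂
  -- pointwise splitting of the cubic sum
  have hpt : ∀ z, ENNReal.ofReal (∑ i, ‖(Φ.flow r z i).2‖ ^ 3) ≤
      ENNReal.ofReal (((N : ℝ) + 1) * M ^ 3) + ENNReal.ofReal ((N : ℝ) + 1) * f₂ z := by
    intro z
    have hI0 : 0 ≤ ∑ i, Set.indicator {v : V3 | M < ‖v‖} (fun v => ‖v‖ ^ 3) ((Φ.flow r z i).2) :=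
      Finset.sum_nonneg fun i _ => Set.indicator_nonneg (fun v _ => by positivity) _
    rw [hf₂, ← ENNReal.ofReal_mul hN.le,
      ← ENNReal.ofReal_add (mul_nonneg hN.le (pow_nonneg hM 3))
        (mul_nonneg hN.le (mul_nonneg (inv_nonneg.2 hN.le) hI0))]
    refine ENNReal.ofReal_le_ofReal ?_
    rw [← mul_assoc, mul_inv_cancel₀ hN.ne', one_mul]
    exact sum_norm_cube_le Φ hM r z
  calc ∫⁻ z, ENNReal.ofReal (∑ i, ‖(Φ.flow r z i).2‖ ^ 3) ∂(localGibbsLaw σ a₀ u₀ θ₀ N Φ)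
      ≤ ∫⁻ z, (ENNReal.ofReal (((N : ℝ) + 1) * M ^ 3) + ENNReal.ofReal ((N : ℝ) + 1) * f₂ z)
          ∂(localGibbsLaw σ a₀ u₀ θ₀ N Φ) := lintegral_mono hpt
    _ = ENNReal.ofReal (((N : ℝ) + 1) * M ^ 3) +
          ENNReal.ofReal ((N : ℝ) + 1) * ∫⁻ z, f₂ z ∂(localGibbsLaw σ a₀ u₀ θ₀ N Φ) := by
        rw [lintegral_add_left measurable_const, lintegral_const, measure_univ, mul_one,
          lintegral_const_mul' _ _ ENNReal.ofReal_ne_top]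
    _ ≤ ENNReal.ofReal (((N : ℝ) + 1) * M ^ 3) + ENNReal.ofReal ((N : ℝ) + 1) * ENNReal.ofReal 1 := by
        gcongr
    _ = ENNReal.ofReal (((N : ℝ) + 1) * (M ^ 3 + 1)) := by
        rw [← ENNReal.ofReal_mul hN.le, ← ENNReal.ofReal_add (mul_nonneg hN.le (pow_nonneg hM 3)) (by positivity)]
        congr 1
        ring

/-- **TM — third moments over a window under the true law** (registered stub of line `IdeatorTwoSketch`, crux
`ClampedCurrentsDock`): `E_λ[∫_s^{s+w} Σ_i ‖v_i(r)‖³ dr] ≤ w (N+1) (M³ + 1)` from the per-time cubic tails at accuracy `1`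
on `[s, s + w]` — Tonelli in `(r, z)` on the good set plus `lintegral_cubeSum_le` at each time. [folklore] -/
theorem stub_thirdMomentWindow : ThirdMomentWindow := by
  intro σ N Φ a₀ θ₀ u₀ M s w _hσ hσ2 ha hθ hu ha0 hθ0 hM _hs hw hECT
  haveI := isProbabilityMeasure_localGibbsLaw ha hθ hu ha0 hθ0 hσ2.le N Φ
  have hsw : s ≤ s + w := le_add_of_nonneg_right hw
  -- the jointly measurable integrand through the modified flow
  set F : Config (N + 1) (Fin 3) T3 × ℝ → ℝ≥0∞ := fun p =>
    ENNReal.ofReal (∑ i, ‖(flowMod Φ (p.2, p.1) i).2‖ ^ 3) with hF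
  have hFm : Measurable F := by
    refine (Finset.measurable_sum _ fun i _ => ?_).ennreal_ofReal
    exact (((measurable_pi_apply i).comp ((measurable_flowMod Φ).comp
      (measurable_snd.prodMk measurable_fst))).snd.norm.pow_const 3)
  have hgood := ae_mem_good_localGibbsLaw σ a₀ θ₀ u₀ N Φ
  -- (1) the inner time integral as a lower integral of `F`, on the good set
  have h1 : ∀ᵐ z ∂(localGibbsLaw σ a₀ u₀ θ₀ N Φ),
      ENNReal.ofReal (∫ r in s..(s + w), ∑ i : Fin (N + 1), ‖(Φ.flow r z i).2‖ ^ 3) =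
        ∫⁻ r in Ioc s (s + w), F (z, r) := by
    filter_upwards [hgood] with z hz
    rw [intervalIntegral.integral_of_le hsw,
      ofReal_integral_eq_lintegral_ofReal (integrableOn_cubeSum Φ hz s (s + w))
        (ae_of_all _ fun r => Finset.sum_nonneg fun i _ => by positivity)]
    refine lintegral_congr fun r => ?_
    simp only [hF, flowMod_of_mem Φ hz]
  -- (2) Tonelli
  have h2 : ∫⁻ z, (∫⁻ r in Ioc s (s + w), F (z, r)) ∂(localGibbsLaw σ a₀ u₀ θ₀ N Φ) =
      ∫⁻ r in Ioc s (s + w), ∫⁻ z, F (z, r) ∂(localGibbsLaw σ a₀ u₀ θ₀ N Φ) :=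
    lintegral_lintegral_swap hFm.aemeasurable
  -- (3) at each time of the window
  have h3 : ∀ r ∈ Ioc s (s + w), ∫⁻ z, F (z, r) ∂(localGibbsLaw σ a₀ u₀ θ₀ N Φ) ≤
      ENNReal.ofReal (((N : ℝ) + 1) * (M ^ 3 + 1)) := by
    intro r hr
    calc ∫⁻ z, F (z, r) ∂(localGibbsLaw σ a₀ u₀ θ₀ N Φ)
        = ∫⁻ z, ENNReal.ofReal (∑ i, ‖(Φ.flow r z i).2‖ ^ 3) ∂(localGibbsLaw σ a₀ u₀ θ₀ N Φ) := by
          refine lintegral_congr_ae ?_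
          filter_upwards [hgood] with z hz
          simp only [hF, flowMod_of_mem Φ hz]
      _ ≤ ENNReal.ofReal (((N : ℝ) + 1) * (M ^ 3 + 1)) :=
          lintegral_cubeSum_le hσ2.le ha hθ hu ha0 hθ0 Φ hM (hECT r ⟨hr.1.le, hr.2⟩)
  calc ∫⁻ z, ENNReal.ofReal (∫ r in s..(s + w), ∑ i : Fin (N + 1), ‖(Φ.flow r z i).2‖ ^ 3)
        ∂(localGibbsLaw σ a₀ u₀ θ₀ N Φ)
      = ∫⁻ z, (∫⁻ r in Ioc s (s + w), F (z, r)) ∂(localGibbsLaw σ a₀ u₀ θ₀ N Φ) := lintegral_congr_ae h1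
    _ = ∫⁻ r in Ioc s (s + w), ∫⁻ z, F (z, r) ∂(localGibbsLaw σ a₀ u₀ θ₀ N Φ) := h2
    _ ≤ ∫⁻ _r in Ioc s (s + w), ENNReal.ofReal (((N : ℝ) + 1) * (M ^ 3 + 1)) :=
        setLIntegral_mono' measurableSet_Ioc h3
    _ = ENNReal.ofReal (w * ((N : ℝ) + 1) * (M ^ 3 + 1)) := by
        rw [setLIntegral_const, Real.volume_Ioc, add_sub_cancel_left, ← ENNReal.ofReal_mul' hw]
        congr 1
        ring

end Summit.AtomisticToContinuum.HydrodynamicLimit.Theorems.ClampedCurrentsDockThirdMoment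

end
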